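import Literature.Probability.RandomPlanarGeometry.HexSAWSurfaceWallRenewalSlackFourThreeDownFamilies
import Literature.Probability.RandomPlanarGeometry.HexSAWSurfaceWallRenewalSlackFourThreeDown
import HarnessLib

/-!
# Slack four, three down steps: the floor `(k − 1)(2k² + 3k − 4)/2 + 1`

Self-avoiding walk on the honeycomb lattice in its brick-wall frame, half-plane `Y ≤ 0`; irreducible positive wall bridges
`ipwb n`, `visits`, `stepsD` / `stepsU` as in `…HexSAWSurfaceWallRenewal`.  At slack four (`n = 6k + 4`, `k` visits,
`k ≥ 2`) the three-down stratum is `{vertical profile D D D U U U} ⊔ {g3b k}` (`three_down_slack_four`,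
`three_down_mixed_iff_eq_g3b` of `…SlackFourThreeDown`), and `…SlackFourThreeDownFamilies` exhibits the Finset
`dddBlocks k` of `(k − 1)(2k² + 3k − 4)/2` explicit `D D D U U U` blocks.  This short module joins the two:

* `dddBlocks_down_lt_up` — in every block of `dddBlocks k` each down step precedes each up step (profile `D D D U U U`);
* `g3b_not_mem_dddBlocks` — the bump-then-hairpin block (up step at time `4`, dive at time `2k + 3`) is none of them;
* `card_stepsD_g3b`, `g3b_mem_filter_three_down` — `g3b k` has exactly three down steps and lies in the stratum;
* ★ `dddBlocks_ssubset` — `dddBlocks k` is a PROPER subset of the three-down stratum, and ★★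
  `le_two_mul_card_filter_visits_three_down_succ : (k − 1)(2k² + 3k − 4) + 2 ≤ 2 · #{ω ∈ ipwb m : visits = k ∧ #stepsD = 3}`
  — the three-down stratum at slack four has at least `(k − 1)(2k² + 3k − 4)/2 + 1 = 6, 24, 61, 123, 216, …` members
  (`k = 2, 3, 4, 5, 6, …`); the lane's enumeration says «exactly» for `k ≤ 15`, the matching upper bound being the
  classification of the `D D D U U U` profile (not here).

STATUS: lane theorem (a-idea-1 lineage, car 86 «three-down floor»); OURS (bookkeeping on cars 79c/85).  The printed
sources carry only the set-up (Madras–Slade §4.2 Definition 4.2.1, (4.2.2); Kesten §4; Enting–Jensen §7.4.2 Fig. 7.10;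
Beaton et al. §3.1).  No `set_option` line is used.
-/

namespace Literature.Probability.RandomPlanarGeometry.SAW.HexBW.Wall

open Finset Filter Function
open Literature.Probability.LatticeModels Literature.Probability.Percolation SimpleGraph

/-- **Profile `D D D U U U`**: in a block of `dddBlocks k` every down step precedes every up step (`k ≥ 2`,
`m = 6k + 4`). [cite: EntingJensen2009, §7.4.2, Fig. 7.10] [cite: MadrasSlade1993, §4.2, Definition 4.2.1 (p. 90)] -/
theorem dddBlocks_down_lt_up {k m : ℕ} {w : ℕ → Site 2} (hk : 2 ≤ k) (hm : m = 6 * k + 4) (hw : w ∈ dddBlocks k)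
    {p r : ℕ} (hp : p ∈ stepsD m w) (hr : r ∈ stepsU m w) : p < r := by
  classical
  simp only [dddBlocks, mem_union] at hw
  rcases hw with (((((((((hw | hw) | hw) | hw) | hw) | hw) | hw) | hw) | hw) | hw)
  · obtain ⟨i, u, h, rfl⟩ := exists_of_mem_a2Img hk hw
    rw [stepsD_s3a (by omega) hm] at hp
    rw [stepsU_s3a (by omega) hm] at hr
    simp only [mem_insert, mem_singleton] at hp hr
    omega
  · obtain ⟨a, i, u, h, rfl⟩ := exists_of_mem_a3Img hk hw
    rw [stepsD_s3b (by omega) (by omega) hm] at hp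
    rw [stepsU_s3b (by omega) (by omega) hm] at hr
    simp only [mem_insert, mem_singleton] at hp hr
    omega
  · obtain ⟨i, u, h, rfl⟩ := exists_of_mem_a4Img hk hw
    rw [stepsD_s3c (by omega) (by omega) hm] at hp
    rw [stepsU_s3c (by omega) (by omega) hm] at hr
    simp only [mem_insert, mem_singleton] at hp hr
    omega
  · obtain ⟨a, i, h, rfl⟩ := exists_of_mem_a5Img hk hw
    rw [stepsD_s3d (by omega) (by omega) (by omega) hm] at hp
    rw [stepsU_s3d (by omega) (by omega) (by omega) hm] at hr
    simp only [mem_insert, mem_singleton] at hp hr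
    omega
  · obtain ⟨a, i, u, h, rfl⟩ := exists_of_mem_a6Img hk hw
    rw [stepsD_s3e (by omega) (by omega) (by omega) hm] at hp
    rw [stepsU_s3e (by omega) (by omega) (by omega) hm] at hr
    simp only [mem_insert, mem_singleton] at hp hr
    omega
  · obtain ⟨a, i, u, h, rfl⟩ := exists_of_mem_b2ImgLo hk hw
    rw [stepsD_s3f (by omega) (by omega) (by omega) hm] at hp
    rw [stepsU_s3f (by omega) (by omega) (by omega) hm] at hr
    simp only [mem_insert, mem_singleton] at hp hr
    omega
  · obtain ⟨a, i, u, h, rfl⟩ := exists_of_mem_b2ImgMid hk hw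
    rw [stepsD_s3f (by omega) (by omega) (by omega) hm] at hp
    rw [stepsU_s3f (by omega) (by omega) (by omega) hm] at hr
    simp only [mem_insert, mem_singleton] at hp hr
    omega
  · obtain ⟨a, i, u, h, rfl⟩ := exists_of_mem_b2ImgHi hk hw
    rw [stepsD_s3f (by omega) (by omega) (by omega) hm] at hp
    rw [stepsU_s3f (by omega) (by omega) (by omega) hm] at hr
    simp only [mem_insert, mem_singleton] at hp hr
    omega
  · obtain ⟨i, u, g, h, rfl⟩ := exists_of_mem_b3ImgLo hk hw
    rw [stepsD_s3g (by omega) (by omega) hm] at hp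
    rw [stepsU_s3g (by omega) (by omega) hm] at hr
    simp only [mem_insert, mem_singleton] at hp hr
    omega
  · obtain ⟨i, u, g, h, rfl⟩ := exists_of_mem_b3ImgHi hk hw
    rw [stepsD_s3g (by omega) (by omega) hm] at hp
    rw [stepsU_s3g (by omega) (by omega) hm] at hr
    simp only [mem_insert, mem_singleton] at hp hr
    omega

/-- **The bump-then-hairpin block is not a `D D D U U U` block**: its up step at time `4` precedes its dive at time
`2k + 3` (`stepsU_g3b`, `stepsD_g3b`). [cite: EntingJensen2009, §7.4.2, Fig. 7.10] -/
theorem g3b_not_mem_dddBlocks {k : ℕ} (hk : 2 ≤ k) : g3b k ∉ dddBlocks k := by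
  classical
  intro h
  have hp : 2 * k + 3 ∈ stepsD (6 * k + 4) (g3b k) := by rw [stepsD_g3b hk rfl]; simp
  have hr : 4 ∈ stepsU (6 * k + 4) (g3b k) := by rw [stepsU_g3b hk rfl]; simp
  have := dddBlocks_down_lt_up hk rfl h hp hr
  omega

/-- `g3b k` has exactly three down steps (`k ≥ 2`, `m = 6k + 4`). [cite: EntingJensen2009, §7.4.2, Fig. 7.10] -/
theorem card_stepsD_g3b {k m : ℕ} (hk : 2 ≤ k) (hm : m = 6 * k + 4) : #(stepsD m (g3b k)) = 3 := by
  rw [stepsD_g3b hk hm]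
  exact card_eq_three.2 ⟨_, _, _, by omega, by omega, by omega, rfl⟩

/-- `g3b k` lies in the three-down stratum at slack four (`k ≥ 2`, `m = 6k + 4`). [cite: MadrasSlade1993, §4.2,
Definition 4.2.1 (p. 90)] [cite: EntingJensen2009, §7.4.2, Fig. 7.10] -/
theorem g3b_mem_filter_three_down {k m : ℕ} (hk : 2 ≤ k) (hm : m = 6 * k + 4) :
    g3b k ∈ (ipwb m).filter fun ω => visits m ω = k ∧ #(stepsD m ω) = 3 :=
  mem_filter.2 ⟨g3b_mem_ipwb hk hm, visits_g3b hk hm, card_stepsD_g3b hk hm⟩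

/-- ★ **`dddBlocks k` is a proper part of the three-down stratum at slack four** (it misses `g3b k`; `k ≥ 2`,
`m = 6k + 4`). [cite: MadrasSlade1993, §4.2, Definition 4.2.1 (p. 90)] [cite: EntingJensen2009, §7.4.2, Fig. 7.10] -/
theorem dddBlocks_ssubset {k m : ℕ} (hk : 2 ≤ k) (hm : m = 6 * k + 4) :
    dddBlocks k ⊂ (ipwb m).filter fun ω => visits m ω = k ∧ #(stepsD m ω) = 3 :=
  Finset.ssubset_iff_subset_ne.2 ⟨dddBlocks_subset hk hm, fun e =>
    g3b_not_mem_dddBlocks hk (by rw [e]; exact g3b_mem_filter_three_down hk hm)⟩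

/-- ★★ **Floor of the three-down stratum at slack four**: for `k ≥ 2` at least `(k − 1)(2k² + 3k − 4)/2 + 1` irreducible
positive wall bridges of length `6k + 4` with `k` surface visits have exactly three down steps (`= 6, 24, 61, 123, 216, …`;
the lane's enumeration gives equality for `k ≤ 15`). [cite: MadrasSlade1993, §4.2, Definition 4.2.1 (p. 90), (4.2.2)]
[cite: Kesten1963SAW, §4] [cite: BeatonBousquetMelouDeGierDuminilCopinGuttmann2014, §3.1 (arXiv v5 p. 8)]
[cite: EntingJensen2009, §7.4.2, Fig. 7.10] -/
theorem le_two_mul_card_filter_visits_three_down_succ {k m : ℕ} (hk : 2 ≤ k) (hm : m = 6 * k + 4) :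
    (k - 1) * (2 * k * k + 3 * k - 4) + 2 ≤
      2 * #((ipwb m).filter fun ω => visits m ω = k ∧ #(stepsD m ω) = 3) := by
  have h1 := card_lt_card (dddBlocks_ssubset hk hm)
  have h2 := two_mul_card_dddBlocks hk
  omega

end Literature.Probability.RandomPlanarGeometry.SAW.HexBW.Wall
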